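import Mathlib
import HarnessLib
import Summits.NavierStokesRegularity.NavierStokesRegularity.Theorems.PoloidalWindowDoorLrcModEntireTHCertGaugeRS
import Summits.NavierStokesRegularity.NavierStokesRegularity.Theorems.PoloidalWindowDoorLrcModEntireTHCertSliceUD8

/-!
# Route `PoloidalWindowDoor`, item `LrcModEntire` (stmt-NavierStokesRegularity-20428) — the RS-GAUGED (TH) datum in unsteady slice letters
# (`…THCertSliceUD8` + `…THCertGaugeRS`): the registered v4.3 stub `stub_localTHEmptyHypNUGRS` from ONE RS-gauged slice-letter leaf, BY NAME

Cell ns-regularity-ideate, seat ns-k2-port-2 g0 (second kernel porter under the LEAD of item 20428, ns-poloidal-K2-p3 g9; `--supports stmt-NavierStokesRegularity-20428`).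
The registered statement (twist_split v4.3) is cert-1's FULL normal form at the base point: Galilean rest frame `u(p₀) = 0` AND the rotation–scaling gauge
`∂₀u₂(p₀) = 0`, `∂₁u₂(p₀) = 1` — in the unsteady slice letters of `…THCertSliceUD8.sliceRelabel` (KERNEL-CERT-FORMAT-g8 §1/§3): point-ZERO letters
`[Rw_0_0, Rf_1_0, If_1_0, Rw_1_0]` (indices `[0, 45, 46, 1]`) and the point-VALUE letter `Iw_1_0 = −1/2` (index `2`; `w₁₀ = (∂₀ − i∂₁)u₂/2 = −i/2`),
transferred from the Cartesian RS datum `…THCertGaugeRS.thLocalDatumZV` by `…JetCertGaugeV.LocalDatumZV.relabelD` (`zerosCheck` by `decide`, `valsCheckD` by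
`decide +kernel`: `Rw_1_0 = ∂₀u₂/2`, `Iw_1_0 = −∂₁u₂/2 ↦ −1/2`).

* `sliceGaugeZerosRS = [0, 45, 46, 1]`, `sliceGaugeValsRS = [(2, −1/2)]`; `sliceZerosRS_check`, `sliceValsRS_check`;
* `thSliceLocalDatumZV` — from the hypotheses of `stub_localTHEmptyHypNUGRS` (all but the sign): `LocalDatumZV` in the 189 unsteady slice letters, law `E'`,
  pins `[twist, μ, μ−1, μ_z, Π_NU]`, zeros `[Rw_0_0, Rf_1_0, If_1_0, Rw_1_0]`, value `Iw_1_0 = −1/2`;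
* `sliceZV_false_of_leaf` — the RS-gauged leaf after chunk folding (`LocalDatumZV.extendS`);
* `localTHEmptyHypNUGRS_of_sliceLeafZV` — **THE REGISTERED v4.3 STATEMENT, VERBATIM, FROM ONE RS-GAUGED SLICE-LETTER LEAF CERTIFICATE** (`leafCheckZV` in the
  slice tables: law `k` of the derivation `steps` from `E'` equals `twist^e₀·μ^e₁·(μ−1)^e₂·μ_z^e₃·Π_NU^e₄` modulo ⟨Rw_0_0, Rf_1_0, If_1_0, Rw_1_0, Iw_1_0 + 1/2⟩,
  checked as: substitute `Iw_1_0 ↦ −1/2`, then every remaining term of the difference contains a zero letter).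

So an engine certificate «pins^e ∈ ⟨E'-rows⟩ + ⟨w₀₀, f₁₀, f₀₁, Re w₁₀, Im w₁₀ + 1/2⟩» in cert-1's letters (the «RS gauge» runs) closes the v4.3 (TH) stub by name.
WHAT THIS IS NOT: not a claim about Navier–Stokes and not a certificate — plumbing. [folklore]
-/

noncomputable section

set_option maxRecDepth 100000

-- the summit and its single sub-problem share the name (CONVENTIONS §1), as in every Theorems file
set_option linter.dupNamespace false

namespace Summit.NavierStokesRegularity.NavierStokesRegularity.Theorems.PoloidalWindowDoorLrcModEntireTHCertSliceGaugeUD8RS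

open _root_.Topology _root_.Filter Set Function
open scoped InnerProductSpace Laplacian
open Literature.Analysis.ValidatedNumerics
open Summit.NavierStokesRegularity.NavierStokesRegularity.Theorems.PoloidalWindowDoorLrcModEntireJetCertDefs
open Summit.NavierStokesRegularity.NavierStokesRegularity.Theorems.PoloidalWindowDoorLrcModEntireJetCertTree
open Summit.NavierStokesRegularity.NavierStokesRegularity.Theorems.PoloidalWindowDoorLrcModEntireJetCertFast2
open Summit.NavierStokesRegularity.NavierStokesRegularity.Theorems.PoloidalWindowDoorLrcModEntireJetCertRelabel
open Summit.NavierStokesRegularity.NavierStokesRegularity.Theorems.PoloidalWindowDoorLrcModEntireJetCertGauge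
open Summit.NavierStokesRegularity.NavierStokesRegularity.Theorems.PoloidalWindowDoorLrcModEntireJetCertGaugeV
open Summit.NavierStokesRegularity.NavierStokesRegularity.Theorems.PoloidalWindowDoorLrcModEntireTHCertLetters
open Summit.NavierStokesRegularity.NavierStokesRegularity.Theorems.PoloidalWindowDoorLrcModEntireTHCert
open Summit.NavierStokesRegularity.NavierStokesRegularity.Theorems.PoloidalWindowDoorLrcModEntireTHCertSteady
open Summit.NavierStokesRegularity.NavierStokesRegularity.Theorems.PoloidalWindowDoorLrcModEntireTHCertGauge
open Summit.NavierStokesRegularity.NavierStokesRegularity.Theorems.PoloidalWindowDoorLrcModEntireTHCertGaugeRS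
open Summit.NavierStokesRegularity.NavierStokesRegularity.Theorems.PoloidalWindowDoorLrcModEntireTHCertSliceUD8

/-- The point-zero letters of the RS gauge in the unsteady slice letters: indices of `Rw_0_0, Rf_1_0, If_1_0, Rw_1_0`. [folklore] -/
def sliceGaugeZerosRS : List ℕ := [0, 45, 46, 1]

/-- The point-value letter of the RS gauge in the unsteady slice letters: `Iw_1_0 = −1/2` (index `2`). [folklore] -/
def sliceGaugeValsRS : List (ℕ × ℚ) := [(2, -1/2)]

/-- The zero-letter transfer checks: each is a multiple of a Cartesian RS zero letter (`u₂, u₀/2, −u₁/2, ∂₀u₂/2`). [folklore] -/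
theorem sliceZerosRS_check :
    zerosCheck sliceLetters.length sliceRelabel (gaugeZerosRS sliceLetters) sliceGaugeZerosRS = true := by
  decide

/-- The value-letter transfer check: `Iw_1_0 = −∂₁u₂/2` takes the value `−1/2` at `p₀` when `∂₁u₂(p₀) = 1`. [folklore] -/
theorem sliceValsRS_check :
    valsCheckD sliceLetters.length sliceRelabel (gaugeZerosRS sliceLetters) (gaugeValsRS sliceLetters) sliceGaugeValsRS = true := by
  decide +kernel

/-- **THE RS-GAUGED (TH) DATUM IN UNSTEADY SLICE LETTERS**, from the hypotheses of the registered v4.3 stub (the sign `μ(p₀) < 0` unused). [folklore] -/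
theorem thSliceLocalDatumZV
    {u : ℝ → EuclideanSpace ℝ (Fin 3) → EuclideanSpace ℝ (Fin 3)} {μ A : ℝ → ℝ → ℝ}
    {U : Set (ℝ × EuclideanSpace ℝ (Fin 3))} {p₀ : ℝ × EuclideanSpace ℝ (Fin 3)} (hU : IsOpen U) (hp₀ : p₀ ∈ U)
    (hu : AnalyticOnNhd ℝ (Function.uncurry u) U)
    (hμ : ∀ p ∈ U, AnalyticAt ℝ (Function.uncurry μ) (p.1, p.2 2)) (hA : ∀ p ∈ U, AnalyticAt ℝ (Function.uncurry A) (p.1, p.2 2))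
    (hpol : ∀ p ∈ U, fderiv ℝ (u p.1) p.2 (EuclideanSpace.single 0 1) 1 = fderiv ℝ (u p.1) p.2 (EuclideanSpace.single 1 1) 0)
    (hdiv : ∀ p ∈ U, fderiv ℝ (u p.1) p.2 (EuclideanSpace.single 0 1) 0 + fderiv ℝ (u p.1) p.2 (EuclideanSpace.single 1 1) 1 +
      fderiv ℝ (u p.1) p.2 (EuclideanSpace.single 2 1) 2 = 0)
    (hsh : ∀ p ∈ U, ∀ b : Fin 3, b ≠ 2 →
      fderiv ℝ (u p.1) p.2 (EuclideanSpace.single 2 1) b = μ p.1 (p.2 2) * fderiv ℝ (u p.1) p.2 (EuclideanSpace.single b 1) 2)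
    (hE : ∀ p ∈ U,
      (1 - μ p.1 (p.2 2)) *
          (deriv (fun s => u s p.2 2) p.1 + fderiv ℝ (fun y => u p.1 y 2) p.2 (u p.1 p.2) - Δ (fun y => u p.1 y 2) p.2) =
        A p.1 (p.2 2) + (deriv (fun s => μ s (p.2 2)) p.1 - deriv (deriv (μ p.1)) (p.2 2)) * u p.1 p.2 2
          + deriv (μ p.1) (p.2 2) / 2 * u p.1 p.2 2 ^ 2 - 2 * deriv (μ p.1) (p.2 2) * fderiv ℝ (u p.1) p.2 (EuclideanSpace.single 2 1) 2)
    (htw : fderiv ℝ (fun y => fderiv ℝ (u p₀.1) y (EuclideanSpace.single 2 1) 2) p₀.2 (EuclideanSpace.single 0 1) *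
            fderiv ℝ (u p₀.1) p₀.2 (EuclideanSpace.single 1 1) 2 -
          fderiv ℝ (fun y => fderiv ℝ (u p₀.1) y (EuclideanSpace.single 2 1) 2) p₀.2 (EuclideanSpace.single 1 1) *
            fderiv ℝ (u p₀.1) p₀.2 (EuclideanSpace.single 0 1) 2 ≠ 0)
    (hm0 : μ p₀.1 (p₀.2 2) ≠ 0) (hm1 : μ p₀.1 (p₀.2 2) ≠ 1) (hmz : deriv (μ p₀.1) (p₀.2 2) ≠ 0)
    (hNU : fderiv ℝ (u p₀.1) p₀.2 (EuclideanSpace.single 0 1) 0 ≠ fderiv ℝ (u p₀.1) p₀.2 (EuclideanSpace.single 1 1) 1 ∨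
      fderiv ℝ (u p₀.1) p₀.2 (EuclideanSpace.single 1 1) 0 ≠ 0)
    (hrest : u p₀.1 p₀.2 = 0)
    (hx0 : fderiv ℝ (u p₀.1) p₀.2 (EuclideanSpace.single 0 1) 2 = 0)
    (hy1 : fderiv ℝ (u p₀.1) p₀.2 (EuclideanSpace.single 1 1) 2 = 1) :
    LocalDatumZV (E := ℝ × EuclideanSpace ℝ (Fin 3)) sliceRelabel.m sliceRelabel.Sf sliceRelabel.Mf dirVec sliceRelabel.hyps' sliceRelabel.pins'
      sliceGaugeZerosRS sliceGaugeValsRS :=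
  LocalDatumZV.relabelD sliceRelabel sliceGaugeZerosRS sliceGaugeValsRS sliceRelabel_check sliceZerosRS_check sliceValsRS_check
    (thLocalDatumZV sliceLetters sliceLetters_ok hU hp₀ hu hμ hA hpol hdiv hsh hE htw hm0 hm1 hmz hNU hrest hx0 hy1)

/-- An RS-gauged slice leaf against the chunk-extended laws `E' ∷ Ts` closes the goal (fold `LocalDatumZV.extendS` over the chunks first). [folklore] -/
theorem sliceZV_false_of_leaf (Ts : List QMvPoly) (steps : List (List (QMvPoly × ℕ × List ℕ))) (k : ℕ) (e : List ℕ)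
    (hcheck : leafCheckZV sliceRelabel.m sliceRelabel.Sf sliceRelabel.Mf (sliceRelabel.hyps' ++ Ts) sliceRelabel.pins' sliceGaugeZerosRS
      sliceGaugeValsRS steps k e = true)
    (hdat : LocalDatumZV (E := ℝ × EuclideanSpace ℝ (Fin 3)) sliceRelabel.m sliceRelabel.Sf sliceRelabel.Mf dirVec (sliceRelabel.hyps' ++ Ts)
      sliceRelabel.pins' sliceGaugeZerosRS sliceGaugeValsRS) : False :=
  LocalDatumZV.false_of_leaf hdat hcheck

/-- **THE REGISTERED STUB `stub_localTHEmptyHypNUGRS` (twist_split v4.3, VERBATIM) FROM ONE RS-GAUGED SLICE-LETTER LEAF CERTIFICATE**: a derivation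
`steps` from the single slice law `E'` (in the unsteady slice tables) whose law `k` equals `twist^e₀·μ^e₁·(μ−1)^e₂·μ_z^e₃·Π_NU^e₄` up to terms that,
after the substitution `Iw_1_0 ↦ −1/2`, contain `Rw_0_0`, `Rf_1_0`, `If_1_0` or `Rw_1_0`. [folklore] -/
theorem localTHEmptyHypNUGRS_of_sliceLeafZV (steps : List (List (QMvPoly × ℕ × List ℕ))) (k : ℕ) (e : List ℕ)
    (hcheck : leafCheckZV sliceRelabel.m sliceRelabel.Sf sliceRelabel.Mf sliceRelabel.hyps' sliceRelabel.pins' sliceGaugeZerosRS sliceGaugeValsRS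
      steps k e = true) :
    ∀ (u : ℝ → EuclideanSpace ℝ (Fin 3) → EuclideanSpace ℝ (Fin 3)) (μ A : ℝ → ℝ → ℝ)
      (U : Set (ℝ × EuclideanSpace ℝ (Fin 3))) (p₀ : ℝ × EuclideanSpace ℝ (Fin 3)),
      IsOpen U → p₀ ∈ U →
      AnalyticOnNhd ℝ (Function.uncurry u) U →
      (∀ p ∈ U, AnalyticAt ℝ (Function.uncurry μ) (p.1, p.2 2)) →
      (∀ p ∈ U, AnalyticAt ℝ (Function.uncurry A) (p.1, p.2 2)) →
      (∀ p ∈ U, fderiv ℝ (u p.1) p.2 (EuclideanSpace.single 0 1) 1 = fderiv ℝ (u p.1) p.2 (EuclideanSpace.single 1 1) 0) →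
      (∀ p ∈ U, fderiv ℝ (u p.1) p.2 (EuclideanSpace.single 0 1) 0 + fderiv ℝ (u p.1) p.2 (EuclideanSpace.single 1 1) 1 +
        fderiv ℝ (u p.1) p.2 (EuclideanSpace.single 2 1) 2 = 0) →
      (∀ p ∈ U, ∀ b : Fin 3, b ≠ 2 →
        fderiv ℝ (u p.1) p.2 (EuclideanSpace.single 2 1) b =
          μ p.1 (p.2 2) * fderiv ℝ (u p.1) p.2 (EuclideanSpace.single b 1) 2) →
      (∀ p ∈ U,
        (1 - μ p.1 (p.2 2)) *
            (deriv (fun s => u s p.2 2) p.1 + fderiv ℝ (fun y => u p.1 y 2) p.2 (u p.1 p.2)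
              - Δ (fun y => u p.1 y 2) p.2) =
          A p.1 (p.2 2) + (deriv (fun s => μ s (p.2 2)) p.1 - deriv (deriv (μ p.1)) (p.2 2)) * u p.1 p.2 2
            + deriv (μ p.1) (p.2 2) / 2 * u p.1 p.2 2 ^ 2
            - 2 * deriv (μ p.1) (p.2 2) * fderiv ℝ (u p.1) p.2 (EuclideanSpace.single 2 1) 2) →
      fderiv ℝ (fun y => fderiv ℝ (u p₀.1) y (EuclideanSpace.single 2 1) 2) p₀.2 (EuclideanSpace.single 0 1) *
            fderiv ℝ (u p₀.1) p₀.2 (EuclideanSpace.single 1 1) 2 -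
          fderiv ℝ (fun y => fderiv ℝ (u p₀.1) y (EuclideanSpace.single 2 1) 2) p₀.2 (EuclideanSpace.single 1 1) *
            fderiv ℝ (u p₀.1) p₀.2 (EuclideanSpace.single 0 1) 2 ≠ 0 →
      μ p₀.1 (p₀.2 2) ≠ 0 → μ p₀.1 (p₀.2 2) ≠ 1 → deriv (μ p₀.1) (p₀.2 2) ≠ 0 →
      μ p₀.1 (p₀.2 2) < 0 →
      (fderiv ℝ (u p₀.1) p₀.2 (EuclideanSpace.single 0 1) 0 ≠ fderiv ℝ (u p₀.1) p₀.2 (EuclideanSpace.single 1 1) 1 ∨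
        fderiv ℝ (u p₀.1) p₀.2 (EuclideanSpace.single 1 1) 0 ≠ 0) →
      u p₀.1 p₀.2 = 0 →
      fderiv ℝ (u p₀.1) p₀.2 (EuclideanSpace.single 0 1) 2 = 0 →
      fderiv ℝ (u p₀.1) p₀.2 (EuclideanSpace.single 1 1) 2 = 1 → False := by
  intro u μ A U p₀ hU hp₀ hu hμ hA hpol hdiv hsh hE htw hm0 hm1 hmz _hneg hNU hrest hx0 hy1
  exact LocalDatumZV.false_of_leaf (thSliceLocalDatumZV hU hp₀ hu hμ hA hpol hdiv hsh hE htw hm0 hm1 hmz hNU hrest hx0 hy1) hcheck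

end Summit.NavierStokesRegularity.NavierStokesRegularity.Theorems.PoloidalWindowDoorLrcModEntireTHCertSliceGaugeUD8RS

end
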